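import Mathlib
import HarnessLib
import Summits.HubbardSuperconductivity.HubbardSuperconductivity.Theorems.KLProgrammeKLRegimeEngineLastRespSymbolSups
import Summits.HubbardSuperconductivity.HubbardSuperconductivity.Theorems.KLProgrammeKLRegimeEngineFrameShiftDressingFactorTablesG
import Summits.HubbardSuperconductivity.HubbardSuperconductivity.Theorems.KLProgrammeKLRegimeEngineFlowEnvelopeChoice
import Summits.HubbardSuperconductivity.HubbardSuperconductivity.Theorems.KLProgrammeSmoothTransitionGevreySharp
import Summits.HubbardSuperconductivity.HubbardSuperconductivity.Theorems.KLProgrammeSalmhoferCutoffDerivTableRecordV2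

/-!
# K3 gen-8-FLOW (stmt 20437, stub (C), located item #20, cure (δ′) «LAST-STEP SWAP», layer F3e′): THE SYMBOL SUPS AT THE FLOW STEP FROM ENGINE DATA —
# the `hDg_X`/`hA₀_X` inputs of `lastResponse_bracket_flow_sharp` with every table discharged (cutoff numerals, band/mismatch envelopes, closed (Ξ, Θ, Φ))

Cell gate-hubbard-kl, seat p2 g20 (successor item (iii) «symbol-sup pre-packaging» of HOME/HANDOFF § p2 g17 FINAL).  `…EngineLastRespSymbolSups`
(p614609) bounds every Fréchet jet of the three last-step symbols `−J₂`, `J₁`, `−i·J₁` (band `u = e_{K_o}`, mismatch `v = K_o ⊖ K_n`, weight one at scale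
`Λ_N`) by Gevrey-2 expressions GIVEN a cutoff table `‖χ₂^{(l)}‖ ≤ X₀(l!)²C_χ^l`, band/mismatch tables `‖Dⁱu‖ ≤ i!E_uⁱ`, `‖Dⁱv‖ ≤ δ·i!F_vⁱ` and `δ ≤ Λ_N/4`.
Here all of them are DISCHARGED at the flow step `K_m → K_{m+1}` (weight `Λ_{m+1}`; the bracket reads `m = n_β`):

* §1 `frameLevel_flowFrame_jets_of_env_at` — the band envelope AT `K_m` for EVERY `m` (incl. `m = 0`): `‖Dⁱe_{K_m}‖ ≤ i!(4 + 4^mΞ)ⁱ`, `1 ≤ i`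
  (p2 g14's `…_of_env` is stated at `K_{m+1}`); `flowMismatch_rev_jets_of_env` — the REVERSED mismatch `K_m ⊖ K_{m+1} = −(K_{m+1} ⊖ K_m)`:
  `‖Dⁱ‖ ≤ (Gfr₀|U|Θ16^{−m})·i!·(2^{10}Φ4^m)ⁱ`, every `i` — both from the history `hP`/`hT` (piece jets, reading jets at the scales `≤ n`) and the
  m-free envelope hypotheses `hΞ`/`hΘΦ` of `…FrameShiftDressingFactorTablesG`, with the order-4 cutoff table := p2 g18's PROVED `klChi2CauchyTab2 4`;
* §2 `lastNegJ₂_sup_flow_le_gevrey`, `lastJ₁_sup_flow_le_gevrey`, `lastNegIJ₁_sup_flow_le_gevrey` — every order `k`, every `q`, generic `(Ξ, Θ, Φ)`,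
  Gevrey cutoff table := p2 g18's PROVED `salmhoferCutoff_gevrey_table_sharp2` (`X₀ = 5`, `C_χ = 27/10`), under `δ ≤ Λ_{m+1}/4`;
* §3 the CLOSED choice (p2 g15 `…FlowEnvelopeChoice`): `Φ := 1`, `Ξ := 2^{10}(1 + π⁸WU²/2^{11}) + Σ_{j<5}Gfr_j`, `Θ := 1 + (Σ_{j<5}Gfr_j + π⁸W/2^{11})|U|/Gfr₀`,
  `W := curveExtC X₄ G.S 1 + curveExtC X₄ Q.S′ 1·|U|` (`X₄ = klChi2CauchyTab2 4`) — `Gfr_mul_Theta_inv_pow_le_klScale_succ_div_four` (the `δ ≤ Λ_{m+1}/4`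
  line from ONE `U`-door `Gfr₀|U| + (Σ_{j<5}Gfr_j + π⁸W/2^{11})U² ≤ 1/512`) and `lastNegJ₂/lastJ₁/lastNegIJ₁_sup_flow_le_closed`: the three sups from
  `hR, 0 < Gfr₀, hGS, hQS, 0 < β, μ ∈ klWindowC, |U| ≤ 1`, the door and the history ONLY (parameters `W, Ξ, Θ` bound by their defining equations).

At `m := nScales β` these are literally the `hDg_a/hA₀_a` (`k := Mg`, `k := 0`), `hDg_b/hA₀_b`, `hDg_c/hA₀_c` of `lastResponse_bracket_flow_sharp` (p617972).
Proofs only (composition); no definitions; nothing asserts superconductivity.  Refs: BGM 2006 §2.2 (2.9), (2.23), (2.27)–(2.28), §3 (3.2)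
[cite: BenfattoGiulianiMastropietro2006]; FST 1996 §1 [cite: FeldmanSalmhoferTrubowitz1996].
-/

noncomputable section

namespace Summit.HubbardSuperconductivity.HubbardSuperconductivity.Theorems.EngineV8

set_option linter.dupNamespace false -- summit = problem name (single-conjunct summit), D-0017

open Complex Real Finset Literature.MathematicalPhysics.QuantumLattice Literature.Probability.LatticeModels
open Summit.HubbardSuperconductivity.HubbardSuperconductivity.Theorems.KLRegimeSplit
open Summit.HubbardSuperconductivity.HubbardSuperconductivity.Theorems.DispersionFlow
open Summit.HubbardSuperconductivity.HubbardSuperconductivity.Theorems.KLProgrammeLegKernels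
open scoped Nat

variable {L M : ℕ} [NeZero L] [NeZero M]

/-! ## §1 Band and reversed-mismatch envelopes at the flow step `K_m → K_{m+1}` -/

/-- **THE BAND ENVELOPE AT `K_m`, EVERY `m`**: if the piece table satisfies `A_i ≤ i!·Ξⁱ` for `1 ≤ i` then `‖Dⁱ e_{K_m}(q)‖ ≤ i!·(4 + 4^m·Ξ)ⁱ` for all `1 ≤ i`, `q`
(history up to `n`, `m ≤ n + 1`; at `m = 0` the sum over earlier pieces is empty). [cite: BenfattoGiulianiMastropietro2006, §3 (3.2)] -/
theorem frameLevel_flowFrame_jets_of_env_at {G : GeoConsts} {Q : EngConsts} {R : RenConsts} (hR : ∀ j, 0 ≤ R.Gfr j) (hGS : ∀ k, 0 ≤ G.S k)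
    (hQS : ∀ k, 0 ≤ Q.S' k) {β U μ : ℝ} (hμ : μ ∈ klWindowC) {X₄ : ℝ} (hX4 : ∀ l ≤ 4, ∀ x : ℝ, ‖iteratedFDeriv ℝ l salmhoferCutoff x‖ ≤ X₄)
    {n : ℕ} (hP : ∀ m ≤ n, FlowPieceJetsAt L M β U μ R m) (hT : ∀ m ≤ n, TwoLegReadJetsF L M G Q β U μ m)
    {m : ℕ} (hmn : m ≤ n + 1) {Ξ : ℝ} (hΞ0 : 0 ≤ Ξ) (hΞ : ∀ i, 1 ≤ i → (if i ≤ 4 then R.Gfr i * uPow i U else 2 ^ i * (Real.pi ^ 8 / 4 * 2 ^ (i - 1) * (2 : ℝ) ^ (8 * (i - 1))) * ((curveExtC X₄ G.S 1 + curveExtC X₄ Q.S' 1 * |U|) * U ^ 2)) ≤ i ! * Ξ ^ i) {i : ℕ} (hi : 1 ≤ i) (q : Momentum) :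
    ‖iteratedFDeriv ℝ i (frameLevel μ (klFlowFrameU L M β U μ m)) q‖ ≤ i ! * (4 + (4 : ℝ) ^ m * Ξ) ^ i := by
  have hX0 : 0 ≤ X₄ := (norm_nonneg _).trans (hX4 0 (by norm_num) 0)
  set A : ℝ := (if i ≤ 4 then R.Gfr i * uPow i U else 2 ^ i * (Real.pi ^ 8 / 4 * 2 ^ (i - 1) * (2 : ℝ) ^ (8 * (i - 1))) * ((curveExtC X₄ G.S 1 + curveExtC X₄ Q.S' 1 * |U|) * U ^ 2)) with hA
  have hA0 : 0 ≤ A := flowPiece_tableA_nonneg hR hGS hQS hX0 U i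
  have h := frameLevel_flowFrame_jets_allOrders (L := L) (M := M) hGS hQS hμ hX4 hP hT (m := m) hmn hi q
  have hsum : ∑ m' ∈ range m, A * (4 : ℝ) ^ (((i : ℤ) - 2) * m') ≤ A * (4 : ℝ) ^ (i * m) := by
    calc ∑ m' ∈ range m, A * (4 : ℝ) ^ (((i : ℤ) - 2) * m') ≤ ∑ m' ∈ range m, A * (4 : ℝ) ^ ((i - 1) * m) :=
          sum_le_sum fun m' hm' => mul_le_mul_of_nonneg_left (four_zpow_order_le_pow hi (by simp at hm'; omega)) hA0
      _ = ((m : ℕ) : ℝ) * (A * (4 : ℝ) ^ ((i - 1) * m)) := by rw [sum_const, card_range, nsmul_eq_mul]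
      _ ≤ (4 : ℝ) ^ m * (A * (4 : ℝ) ^ ((i - 1) * m)) := by
          refine mul_le_mul_of_nonneg_right ?_ (by positivity)
          exact_mod_cast (Nat.lt_pow_self (by norm_num : 1 < 4) : m < 4 ^ m).le
      _ = A * (4 : ℝ) ^ (i * m) := by
          obtain ⟨k, rfl⟩ : ∃ k, i = k + 1 := ⟨i - 1, by omega⟩
          rw [Nat.add_sub_cancel, mul_left_comm, ← pow_add]
          ring_nf
  have hfac : (1 : ℝ) ≤ i ! := by exact_mod_cast Nat.one_le_iff_ne_zero.2 (Nat.factorial_ne_zero i)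
  have hmain : (4 : ℝ) ^ i + A * (4 : ℝ) ^ (i * m) ≤ i ! * (4 + (4 : ℝ) ^ m * Ξ) ^ i := by
    have h1 : A * (4 : ℝ) ^ (i * m) ≤ i ! * ((4 : ℝ) ^ m * Ξ) ^ i := by
      rw [mul_pow, ← pow_mul, mul_comm m i]
      calc A * (4 : ℝ) ^ (i * m) ≤ (i ! * Ξ ^ i) * (4 : ℝ) ^ (i * m) := mul_le_mul_of_nonneg_right (hΞ i hi) (by positivity)
        _ = i ! * ((4 : ℝ) ^ (i * m) * Ξ ^ i) := by ring
    have h2 : (4 : ℝ) ^ i ≤ i ! * (4 : ℝ) ^ i := le_mul_of_one_le_left (by positivity) hfac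
    calc (4 : ℝ) ^ i + A * (4 : ℝ) ^ (i * m) ≤ i ! * (4 : ℝ) ^ i + i ! * ((4 : ℝ) ^ m * Ξ) ^ i := add_le_add h2 h1
      _ = i ! * ((4 : ℝ) ^ i + ((4 : ℝ) ^ m * Ξ) ^ i) := by ring
      _ ≤ i ! * (4 + (4 : ℝ) ^ m * Ξ) ^ i :=
          mul_le_mul_of_nonneg_left (pow_add_pow_le (by norm_num) (mul_nonneg (by positivity) hΞ0) (by omega)) (by positivity)
  exact h.trans ((add_le_add le_rfl hsum).trans hmain)

/-- **THE REVERSED MISMATCH ENVELOPE**: `K_m ⊖ K_{m+1} = −(K_{m+1} ⊖ K_m)`, so `flowMismatch_jets_of_env`'s bound holds verbatim for the pair in the order the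
last-step symbols read it: `‖Dⁱ evalM (K_m ⊖ K_{m+1})(q)‖ ≤ (Gfr₀|U|Θ·16^{−m})·i!·(2^{10}Φ·4^m)ⁱ`, every `i`, `q`. [cite: BenfattoGiulianiMastropietro2006, §3 (3.2)] -/
theorem flowMismatch_rev_jets_of_env {G : GeoConsts} {Q : EngConsts} {R : RenConsts} (hGS : ∀ k, 0 ≤ G.S k)
    (hQS : ∀ k, 0 ≤ Q.S' k) {β U μ : ℝ} (hμ : μ ∈ klWindowC) {X₄ : ℝ} (hX4 : ∀ l ≤ 4, ∀ x : ℝ, ‖iteratedFDeriv ℝ l salmhoferCutoff x‖ ≤ X₄)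
    {n : ℕ} (hP : ∀ m ≤ n, FlowPieceJetsAt L M β U μ R m) (hT : ∀ m ≤ n, TwoLegReadJetsF L M G Q β U μ m)
    {m : ℕ} (hmn : m ≤ n) {Θ Φ : ℝ} (hΘΦ : ∀ i : ℕ, (if i ≤ 4 then R.Gfr i * uPow i U else 2 ^ i * (Real.pi ^ 8 / 4 * 2 ^ (i - 1) * (2 : ℝ) ^ (8 * (i - 1))) * ((curveExtC X₄ G.S 1 + curveExtC X₄ Q.S' 1 * |U|) * U ^ 2)) ≤ R.Gfr 0 * |U| * Θ * i ! * (2 ^ 10 * Φ) ^ i)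
    (i : ℕ) (q : Momentum) :
    ‖iteratedFDeriv ℝ i (evalM (fsub (klFlowFrameU L M β U μ m) (klFlowFrameU L M β U μ (m + 1)))) q‖ ≤
      (R.Gfr 0 * |U| * Θ * ((16 : ℝ) ^ m)⁻¹) * i ! * (2 ^ 10 * Φ * (4 : ℝ) ^ m) ^ i := by
  have hfun : evalM (fsub (klFlowFrameU L M β U μ m) (klFlowFrameU L M β U μ (m + 1))) =
      -evalM (fsub (klFlowFrameU L M β U μ (m + 1)) (klFlowFrameU L M β U μ m)) := by
    funext q; simp only [Pi.neg_apply, evalM_fsub]; ring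
  rw [hfun, iteratedFDeriv_neg_apply, norm_neg]
  exact flowMismatch_jets_of_env hGS hQS hμ hX4 hP hT hmn hΘΦ i q

/-! ## §2 The three Gevrey sups at the flow step, generic envelopes `(Ξ, Θ, Φ)`, cutoff numerals discharged -/

section Generic

variable {G : GeoConsts} {Q : EngConsts} {R : RenConsts} (hR : ∀ j, 0 ≤ R.Gfr j) (hGS : ∀ k, 0 ≤ G.S k) (hQS : ∀ k, 0 ≤ Q.S' k)
  {β U μ : ℝ} (hβ : 0 < β) (hμ : μ ∈ klWindowC) {n : ℕ} (hP : ∀ m ≤ n, FlowPieceJetsAt L M β U μ R m) (hT : ∀ m ≤ n, TwoLegReadJetsF L M G Q β U μ m)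
  {m : ℕ} (hmn : m ≤ n) {Ξ Θ Φ : ℝ} (hΞ0 : 0 ≤ Ξ) (hΘ0 : 0 ≤ Θ) (hΦ0 : 0 ≤ Φ)
  (hΞ : ∀ i, 1 ≤ i → (if i ≤ 4 then R.Gfr i * uPow i U else 2 ^ i * (Real.pi ^ 8 / 4 * 2 ^ (i - 1) * (2 : ℝ) ^ (8 * (i - 1))) * ((curveExtC (klChi2CauchyTab2 4) G.S 1 + curveExtC (klChi2CauchyTab2 4) Q.S' 1 * |U|) * U ^ 2)) ≤ i ! * Ξ ^ i)
  (hΘΦ : ∀ i : ℕ, (if i ≤ 4 then R.Gfr i * uPow i U else 2 ^ i * (Real.pi ^ 8 / 4 * 2 ^ (i - 1) * (2 : ℝ) ^ (8 * (i - 1))) * ((curveExtC (klChi2CauchyTab2 4) G.S 1 + curveExtC (klChi2CauchyTab2 4) Q.S' 1 * |U|) * U ^ 2)) ≤ R.Gfr 0 * |U| * Θ * i ! * (2 ^ 10 * Φ) ^ i)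
  (hδΛ : R.Gfr 0 * |U| * Θ * ((16 : ℝ) ^ m)⁻¹ ≤ klScale klE0 (m + 1) / 4)
include hR hGS hQS hβ hμ hP hT hmn hΞ0 hΘ0 hΦ0 hΞ hΘΦ hδΛ

/-- **Gevrey sup of `−J₂` (the `R_a` symbol) at the flow step `K_m → K_{m+1}`**, every order `k`, every `q`, generic envelopes; cutoff numerals `X₀ = 5`, `C_χ = 27/10`
(p2 g18) inside. [cite: BenfattoGiulianiMastropietro2006, §2.2 (2.23), (2.27)–(2.28)] -/
theorem lastNegJ₂_sup_flow_le_gevrey (k : ℕ) (q : Momentum) :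
    ‖iteratedFDeriv ℝ k (fun q : Momentum => ((((evalM (fsub (klFlowFrameU L M β U μ m) (klFlowFrameU L M β U μ (m + 1))) q * evalM (fsub (klFlowFrameU L M β U μ m) (klFlowFrameU L M
      β U μ (m + 1))) q) / (β * (L : ℝ) ^ 2) : ℝ)) : ℂ) * (((uvWeightFn (klScale klE0 (m + 1)) (matsubaraFreq β M (omega0 M)) (frameLevel μ (klFlowFrameU L M β U μ m) q) : ℝ) : ℂ) *
      resolventFnXi (β * (L : ℝ) ^ 2) 0 (matsubaraFreq β M (omega0 M)) (frameLevel μ (klFlowFrameU L M β U μ m) q + uvWeightFn (klScale klE0 (m + 1)) (matsubaraFreq β M (omega0 M))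
      (frameLevel μ (klFlowFrameU L M β U μ m) q) * evalM (fsub (klFlowFrameU L M β U μ m) (klFlowFrameU L M β U μ (m + 1))) q))) q‖ ≤
      ((R.Gfr 0 * |U| * Θ * ((16 : ℝ) ^ m)⁻¹) * (R.Gfr 0 * |U| * Θ * ((16 : ℝ) ^ m)⁻¹) / |(β * (L : ℝ) ^ 2)|) * ((5 : ℝ) * (|(β * (L : ℝ) ^ 2)| * (6 / (klScale klE0 (m + 1))))) * ((k !
        : ℝ)) ^ 2 * (2 * (2 * (2 ^ 10 * Φ * (4 : ℝ) ^ m) + 2 * (4 * (2 * (4 * (4 + (4 : ℝ) ^ m * Ξ) * (1 + 16 * (1 + (27 / 10 : ℝ)) / (klScale klE0 (m + 1)) * 1) + (2 ^ 10 * Φ * (4 : ℝ)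
        ^ m))) * (1 + 6 / (klScale klE0 (m + 1)) * ((klScale klE0 (m + 1)) / 128 + (5 : ℝ) * (R.Gfr 0 * |U| * Θ * ((16 : ℝ) ^ m)⁻¹)))))) ^ k := by
  have hX4 := salmhoferCutoff_flat_cauchy_table2 4
  have hδ0 : 0 ≤ R.Gfr 0 * |U| * Θ * ((16 : ℝ) ^ m)⁻¹ := mul_nonneg (mul_nonneg (mul_nonneg (hR 0) (abs_nonneg U)) hΘ0) (by positivity)
  have hEu : (0 : ℝ) ≤ 4 + (4 : ℝ) ^ m * Ξ := add_nonneg (by norm_num) (mul_nonneg (by positivity) hΞ0)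
  have hFv : (0 : ℝ) ≤ 2 ^ 10 * Φ * (4 : ℝ) ^ m := mul_nonneg (mul_nonneg (by norm_num) hΦ0) (by positivity)
  exact lastNegJ₂_sup_le_gevrey (L := L) (M := M) hβ μ (klFlowFrameU L M β U μ m) (klFlowFrameU L M β U μ (m + 1)) (show (1 : ℝ) ≤ 5 by norm_num)
    (show (0 : ℝ) ≤ 27 / 10 by norm_num) (salmhoferCutoff_gevrey_table_sharp2 k) hEu hFv hδ0 hδΛ
    (fun i hi1 _ q => frameLevel_flowFrame_jets_of_env_at hR hGS hQS hμ hX4 hP hT (show m ≤ n + 1 by omega) hΞ0 hΞ hi1 q)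
    (fun i _ q => flowMismatch_rev_jets_of_env hGS hQS hμ hX4 hP hT hmn hΘΦ i q) q

/-- **Gevrey sup of `J₁` (the `R_b` symbol) at the flow step `K_m → K_{m+1}`**, every order `k`, every `q`, generic envelopes; cutoff numerals `X₀ = 5`, `C_χ = 27/10`
(p2 g18) inside. [cite: BenfattoGiulianiMastropietro2006, §2.2 (2.23), (2.27)–(2.28)] -/
theorem lastJ₁_sup_flow_le_gevrey (k : ℕ) (q : Momentum) :
    ‖iteratedFDeriv ℝ k (fun q : Momentum => ((((evalM (fsub (klFlowFrameU L M β U μ m) (klFlowFrameU L M β U μ (m + 1))) q / (β * (L : ℝ) ^ 2) : ℝ)) : ℂ) * (((uvWeightFn (klScale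
      klE0 (m + 1)) (matsubaraFreq β M (omega0 M)) (frameLevel μ (klFlowFrameU L M β U μ m) q) : ℝ) : ℂ) * resolventFnXi (β * (L : ℝ) ^ 2) 0 (matsubaraFreq β M (omega0 M)) (frameLevel
      μ (klFlowFrameU L M β U μ m) q + uvWeightFn (klScale klE0 (m + 1)) (matsubaraFreq β M (omega0 M)) (frameLevel μ (klFlowFrameU L M β U μ m) q) * evalM (fsub (klFlowFrameU L M β U
      μ m) (klFlowFrameU L M β U μ (m + 1))) q))) * ((((evalM (fsub (klFlowFrameU L M β U μ m) (klFlowFrameU L M β U μ (m + 1))) q / (β * (L : ℝ) ^ 2) : ℝ)) : ℂ) * (((uvWeightFn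
      (klScale klE0 (m + 1)) (matsubaraFreq β M (omega0 M)) (frameLevel μ (klFlowFrameU L M β U μ m) q) : ℝ) : ℂ) * resolventFnXi (β * (L : ℝ) ^ 2) 0 (matsubaraFreq β M (omega0 M))
      (frameLevel μ (klFlowFrameU L M β U μ m) q + uvWeightFn (klScale klE0 (m + 1)) (matsubaraFreq β M (omega0 M)) (frameLevel μ (klFlowFrameU L M β U μ m) q) * evalM (fsub
      (klFlowFrameU L M β U μ m) (klFlowFrameU L M β U μ (m + 1))) q))) - (2 : ℂ) * ((((evalM (fsub (klFlowFrameU L M β U μ m) (klFlowFrameU L M β U μ (m + 1))) q / (β * (L : ℝ) ^ 2) :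
      ℝ)) : ℂ) * (((uvWeightFn (klScale klE0 (m + 1)) (matsubaraFreq β M (omega0 M)) (frameLevel μ (klFlowFrameU L M β U μ m) q) : ℝ) : ℂ) * resolventFnXi (β * (L : ℝ) ^ 2) 0
      (matsubaraFreq β M (omega0 M)) (frameLevel μ (klFlowFrameU L M β U μ m) q + uvWeightFn (klScale klE0 (m + 1)) (matsubaraFreq β M (omega0 M)) (frameLevel μ (klFlowFrameU L M β U μ
      m) q) * evalM (fsub (klFlowFrameU L M β U μ m) (klFlowFrameU L M β U μ (m + 1))) q)))) q‖ ≤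
      ((R.Gfr 0 * |U| * Θ * ((16 : ℝ) ^ m)⁻¹) / |(β * (L : ℝ) ^ 2)| * ((5 : ℝ) * (|(β * (L : ℝ) ^ 2)| * (6 / (klScale klE0 (m + 1)))))) * ((R.Gfr 0 * |U| * Θ * ((16 : ℝ) ^ m)⁻¹) / |(β
        * (L : ℝ) ^ 2)| * ((5 : ℝ) * (|(β * (L : ℝ) ^ 2)| * (6 / (klScale klE0 (m + 1)))))) * ((k ! : ℝ)) ^ 2 * (2 * (2 * (2 * (2 ^ 10 * Φ * (4 : ℝ) ^ m) + 2 * (4 * (2 * (4 * (4 + (4 :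
        ℝ) ^ m * Ξ) * (1 + 16 * (1 + (27 / 10 : ℝ)) / (klScale klE0 (m + 1)) * 1) + (2 ^ 10 * Φ * (4 : ℝ) ^ m))) * (1 + 6 / (klScale klE0 (m + 1)) * ((klScale klE0 (m + 1)) / 128 + (5 :
        ℝ) * (R.Gfr 0 * |U| * Θ * ((16 : ℝ) ^ m)⁻¹))))))) ^ k + 2 * (((R.Gfr 0 * |U| * Θ * ((16 : ℝ) ^ m)⁻¹) / |(β * (L : ℝ) ^ 2)|) * ((5 : ℝ) * (|(β * (L : ℝ) ^ 2)| * (6 / (klScale klE0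
        (m + 1))))) * ((k ! : ℝ)) ^ 2 * (2 * (2 * (2 ^ 10 * Φ * (4 : ℝ) ^ m) + 2 * (4 * (2 * (4 * (4 + (4 : ℝ) ^ m * Ξ) * (1 + 16 * (1 + (27 / 10 : ℝ)) / (klScale klE0 (m + 1)) * 1) + (2
        ^ 10 * Φ * (4 : ℝ) ^ m))) * (1 + 6 / (klScale klE0 (m + 1)) * ((klScale klE0 (m + 1)) / 128 + (5 : ℝ) * (R.Gfr 0 * |U| * Θ * ((16 : ℝ) ^ m)⁻¹)))))) ^ k) := by
  have hX4 := salmhoferCutoff_flat_cauchy_table2 4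
  have hδ0 : 0 ≤ R.Gfr 0 * |U| * Θ * ((16 : ℝ) ^ m)⁻¹ := mul_nonneg (mul_nonneg (mul_nonneg (hR 0) (abs_nonneg U)) hΘ0) (by positivity)
  have hEu : (0 : ℝ) ≤ 4 + (4 : ℝ) ^ m * Ξ := add_nonneg (by norm_num) (mul_nonneg (by positivity) hΞ0)
  have hFv : (0 : ℝ) ≤ 2 ^ 10 * Φ * (4 : ℝ) ^ m := mul_nonneg (mul_nonneg (by norm_num) hΦ0) (by positivity)
  exact lastJ₁_sup_le_gevrey (L := L) (M := M) hβ μ (klFlowFrameU L M β U μ m) (klFlowFrameU L M β U μ (m + 1)) (show (1 : ℝ) ≤ 5 by norm_num)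
    (show (0 : ℝ) ≤ 27 / 10 by norm_num) (salmhoferCutoff_gevrey_table_sharp2 k) hEu hFv hδ0 hδΛ
    (fun i hi1 _ q => frameLevel_flowFrame_jets_of_env_at hR hGS hQS hμ hX4 hP hT (show m ≤ n + 1 by omega) hΞ0 hΞ hi1 q)
    (fun i _ q => flowMismatch_rev_jets_of_env hGS hQS hμ hX4 hP hT hmn hΘΦ i q) q

/-- **Gevrey sup of `−i·J₁` (the `R_c` symbol) at the flow step `K_m → K_{m+1}`**, every order `k`, every `q`, generic envelopes; cutoff numerals `X₀ = 5`, `C_χ = 27/10`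
(p2 g18) inside. [cite: BenfattoGiulianiMastropietro2006, §2.2 (2.23), (2.27)–(2.28)] -/
theorem lastNegIJ₁_sup_flow_le_gevrey (k : ℕ) (q : Momentum) :
    ‖iteratedFDeriv ℝ k (fun q : Momentum => -I * (((((evalM (fsub (klFlowFrameU L M β U μ m) (klFlowFrameU L M β U μ (m + 1))) q / (β * (L : ℝ) ^ 2) : ℝ)) : ℂ) * (((uvWeightFn
      (klScale klE0 (m + 1)) (matsubaraFreq β M (omega0 M)) (frameLevel μ (klFlowFrameU L M β U μ m) q) : ℝ) : ℂ) * resolventFnXi (β * (L : ℝ) ^ 2) 0 (matsubaraFreq β M (omega0 M))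
      (frameLevel μ (klFlowFrameU L M β U μ m) q + uvWeightFn (klScale klE0 (m + 1)) (matsubaraFreq β M (omega0 M)) (frameLevel μ (klFlowFrameU L M β U μ m) q) * evalM (fsub
      (klFlowFrameU L M β U μ m) (klFlowFrameU L M β U μ (m + 1))) q))) * ((((evalM (fsub (klFlowFrameU L M β U μ m) (klFlowFrameU L M β U μ (m + 1))) q / (β * (L : ℝ) ^ 2) : ℝ)) : ℂ)
      * (((uvWeightFn (klScale klE0 (m + 1)) (matsubaraFreq β M (omega0 M)) (frameLevel μ (klFlowFrameU L M β U μ m) q) : ℝ) : ℂ) * resolventFnXi (β * (L : ℝ) ^ 2) 0 (matsubaraFreq β M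
      (omega0 M)) (frameLevel μ (klFlowFrameU L M β U μ m) q + uvWeightFn (klScale klE0 (m + 1)) (matsubaraFreq β M (omega0 M)) (frameLevel μ (klFlowFrameU L M β U μ m) q) * evalM
      (fsub (klFlowFrameU L M β U μ m) (klFlowFrameU L M β U μ (m + 1))) q))) - (2 : ℂ) * ((((evalM (fsub (klFlowFrameU L M β U μ m) (klFlowFrameU L M β U μ (m + 1))) q / (β * (L : ℝ)
      ^ 2) : ℝ)) : ℂ) * (((uvWeightFn (klScale klE0 (m + 1)) (matsubaraFreq β M (omega0 M)) (frameLevel μ (klFlowFrameU L M β U μ m) q) : ℝ) : ℂ) * resolventFnXi (β * (L : ℝ) ^ 2) 0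
      (matsubaraFreq β M (omega0 M)) (frameLevel μ (klFlowFrameU L M β U μ m) q + uvWeightFn (klScale klE0 (m + 1)) (matsubaraFreq β M (omega0 M)) (frameLevel μ (klFlowFrameU L M β U μ
      m) q) * evalM (fsub (klFlowFrameU L M β U μ m) (klFlowFrameU L M β U μ (m + 1))) q))))) q‖ ≤
      ((R.Gfr 0 * |U| * Θ * ((16 : ℝ) ^ m)⁻¹) / |(β * (L : ℝ) ^ 2)| * ((5 : ℝ) * (|(β * (L : ℝ) ^ 2)| * (6 / (klScale klE0 (m + 1)))))) * ((R.Gfr 0 * |U| * Θ * ((16 : ℝ) ^ m)⁻¹) / |(β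
        * (L : ℝ) ^ 2)| * ((5 : ℝ) * (|(β * (L : ℝ) ^ 2)| * (6 / (klScale klE0 (m + 1)))))) * ((k ! : ℝ)) ^ 2 * (2 * (2 * (2 * (2 ^ 10 * Φ * (4 : ℝ) ^ m) + 2 * (4 * (2 * (4 * (4 + (4 :
        ℝ) ^ m * Ξ) * (1 + 16 * (1 + (27 / 10 : ℝ)) / (klScale klE0 (m + 1)) * 1) + (2 ^ 10 * Φ * (4 : ℝ) ^ m))) * (1 + 6 / (klScale klE0 (m + 1)) * ((klScale klE0 (m + 1)) / 128 + (5 :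
        ℝ) * (R.Gfr 0 * |U| * Θ * ((16 : ℝ) ^ m)⁻¹))))))) ^ k + 2 * (((R.Gfr 0 * |U| * Θ * ((16 : ℝ) ^ m)⁻¹) / |(β * (L : ℝ) ^ 2)|) * ((5 : ℝ) * (|(β * (L : ℝ) ^ 2)| * (6 / (klScale klE0
        (m + 1))))) * ((k ! : ℝ)) ^ 2 * (2 * (2 * (2 ^ 10 * Φ * (4 : ℝ) ^ m) + 2 * (4 * (2 * (4 * (4 + (4 : ℝ) ^ m * Ξ) * (1 + 16 * (1 + (27 / 10 : ℝ)) / (klScale klE0 (m + 1)) * 1) + (2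
        ^ 10 * Φ * (4 : ℝ) ^ m))) * (1 + 6 / (klScale klE0 (m + 1)) * ((klScale klE0 (m + 1)) / 128 + (5 : ℝ) * (R.Gfr 0 * |U| * Θ * ((16 : ℝ) ^ m)⁻¹)))))) ^ k) := by
  have hX4 := salmhoferCutoff_flat_cauchy_table2 4
  have hδ0 : 0 ≤ R.Gfr 0 * |U| * Θ * ((16 : ℝ) ^ m)⁻¹ := mul_nonneg (mul_nonneg (mul_nonneg (hR 0) (abs_nonneg U)) hΘ0) (by positivity)
  have hEu : (0 : ℝ) ≤ 4 + (4 : ℝ) ^ m * Ξ := add_nonneg (by norm_num) (mul_nonneg (by positivity) hΞ0)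
  have hFv : (0 : ℝ) ≤ 2 ^ 10 * Φ * (4 : ℝ) ^ m := mul_nonneg (mul_nonneg (by norm_num) hΦ0) (by positivity)
  exact lastNegIJ₁_sup_le_gevrey (L := L) (M := M) hβ μ (klFlowFrameU L M β U μ m) (klFlowFrameU L M β U μ (m + 1)) (show (1 : ℝ) ≤ 5 by norm_num)
    (show (0 : ℝ) ≤ 27 / 10 by norm_num) (salmhoferCutoff_gevrey_table_sharp2 k) hEu hFv hδ0 hδΛ
    (fun i hi1 _ q => frameLevel_flowFrame_jets_of_env_at hR hGS hQS hμ hX4 hP hT (show m ≤ n + 1 by omega) hΞ0 hΞ hi1 q)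
    (fun i _ q => flowMismatch_rev_jets_of_env hGS hQS hμ hX4 hP hT hmn hΘΦ i q) q

end Generic

/-! ## §3 The closed choice `(Ξ, Θ, Φ) := (Ξ(R,W,U), Θ(R,W,U), 1)` — one `U`-door, no table hypothesis left -/

omit [NeZero L] [NeZero M] in
/-- **The `δ ≤ Λ_{m+1}/4` line from ONE `U`-door** (the last-step symbols carry the weight of the NEXT scale): if
`Gfr₀|U| + (Σ_{j<5} Gfr_j + π⁸W/2^{11})·U² ≤ 1/512` then `Gfr₀|U|Θ·(16^m)⁻¹ ≤ Λ_{m+1}/4` for every `m` (`Λ_{m+1}/4 = (4^m)⁻¹/512`, `16^m ≥ 4^m`).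
[cite: BenfattoGiulianiMastropietro2006, §3 (3.2)] -/
theorem Gfr_mul_Theta_inv_pow_le_klScale_succ_div_four {R : RenConsts} (hR0 : 0 < R.Gfr 0) {W U : ℝ}
    (hdoor : R.Gfr 0 * |U| + ((∑ j ∈ range 5, R.Gfr j) + Real.pi ^ 8 * W / 2 ^ 11) * U ^ 2 ≤ 1 / 512) (m : ℕ) :
    R.Gfr 0 * |U| * (1 + ((∑ j ∈ range 5, R.Gfr j) + Real.pi ^ 8 * W / 2 ^ 11) * |U| / R.Gfr 0) * ((16 : ℝ) ^ m)⁻¹ ≤ klScale klE0 (m + 1) / 4 := by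
  rw [Gfr_mul_abs_mul_Theta_eq hR0]
  have h16 : ((16 : ℝ) ^ m)⁻¹ ≤ ((4 : ℝ) ^ m)⁻¹ := by
    apply inv_anti₀ (by positivity)
    exact pow_le_pow_left₀ (by norm_num) (by norm_num) m
  have hΛ : klScale klE0 (m + 1) / 4 = 1 / 512 * ((4 : ℝ) ^ m)⁻¹ := by
    simp only [klScale, klE0, pow_succ, mul_inv]
    ring
  rw [hΛ]
  have h0 : 0 ≤ ((16 : ℝ) ^ m)⁻¹ := by positivity
  calc (R.Gfr 0 * |U| + ((∑ j ∈ range 5, R.Gfr j) + Real.pi ^ 8 * W / 2 ^ 11) * U ^ 2) * ((16 : ℝ) ^ m)⁻¹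
      ≤ 1 / 512 * ((16 : ℝ) ^ m)⁻¹ := mul_le_mul_of_nonneg_right hdoor h0
    _ ≤ 1 / 512 * ((4 : ℝ) ^ m)⁻¹ := by gcongr

section Closed

variable {G : GeoConsts} {Q : EngConsts} {R : RenConsts} (hR : ∀ j, 0 ≤ R.Gfr j) (hR0 : 0 < R.Gfr 0) (hGS : ∀ k, 0 ≤ G.S k) (hQS : ∀ k, 0 ≤ Q.S' k)
  {β U μ : ℝ} (hβ : 0 < β) (hμ : μ ∈ klWindowC) (hU1 : |U| ≤ 1) {n : ℕ} (hP : ∀ m ≤ n, FlowPieceJetsAt L M β U μ R m)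
  (hT : ∀ m ≤ n, TwoLegReadJetsF L M G Q β U μ m) {m : ℕ} (hmn : m ≤ n) {W Ξ Θ : ℝ}
  (hW : W = curveExtC (klChi2CauchyTab2 4) G.S 1 + curveExtC (klChi2CauchyTab2 4) Q.S' 1 * |U|)
  (hΞ : Ξ = 2 ^ 10 * (1 + Real.pi ^ 8 * (W * U ^ 2) / 2 ^ 11) + ∑ j ∈ range 5, R.Gfr j)
  (hΘ : Θ = 1 + ((∑ j ∈ range 5, R.Gfr j) + Real.pi ^ 8 * W / 2 ^ 11) * |U| / R.Gfr 0)
  (hdoor : R.Gfr 0 * |U| + ((∑ j ∈ range 5, R.Gfr j) + Real.pi ^ 8 * W / 2 ^ 11) * U ^ 2 ≤ 1 / 512)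
include hR hR0 hGS hQS hβ hμ hU1 hP hT hmn hW hΞ hΘ hdoor

/-- **Gevrey sup of `−J₂` (the `R_a` symbol) at the flow step, CLOSED ENVELOPES** (`Φ = 1`; `W, Ξ, Θ` bound by their defining equations `hW, hΞ, hΘ`; one `U`-door).
[cite: BenfattoGiulianiMastropietro2006, §2.2 (2.23), (2.27)–(2.28), §3 (3.2)] -/
theorem lastNegJ₂_sup_flow_le_closed (k : ℕ) (q : Momentum) :
    ‖iteratedFDeriv ℝ k (fun q : Momentum => ((((evalM (fsub (klFlowFrameU L M β U μ m) (klFlowFrameU L M β U μ (m + 1))) q * evalM (fsub (klFlowFrameU L M β U μ m) (klFlowFrameU L M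
      β U μ (m + 1))) q) / (β * (L : ℝ) ^ 2) : ℝ)) : ℂ) * (((uvWeightFn (klScale klE0 (m + 1)) (matsubaraFreq β M (omega0 M)) (frameLevel μ (klFlowFrameU L M β U μ m) q) : ℝ) : ℂ) *
      resolventFnXi (β * (L : ℝ) ^ 2) 0 (matsubaraFreq β M (omega0 M)) (frameLevel μ (klFlowFrameU L M β U μ m) q + uvWeightFn (klScale klE0 (m + 1)) (matsubaraFreq β M (omega0 M))
      (frameLevel μ (klFlowFrameU L M β U μ m) q) * evalM (fsub (klFlowFrameU L M β U μ m) (klFlowFrameU L M β U μ (m + 1))) q))) q‖ ≤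
      ((R.Gfr 0 * |U| * Θ * ((16 : ℝ) ^ m)⁻¹) * (R.Gfr 0 * |U| * Θ * ((16 : ℝ) ^ m)⁻¹) / |(β * (L : ℝ) ^ 2)|) * ((5 : ℝ) * (|(β * (L : ℝ) ^ 2)| * (6 / (klScale klE0 (m + 1))))) * ((k !
        : ℝ)) ^ 2 * (2 * (2 * (2 ^ 10 * (1 : ℝ) * (4 : ℝ) ^ m) + 2 * (4 * (2 * (4 * (4 + (4 : ℝ) ^ m * Ξ) * (1 + 16 * (1 + (27 / 10 : ℝ)) / (klScale klE0 (m + 1)) * 1) + (2 ^ 10 * (1 :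
        ℝ) * (4 : ℝ) ^ m))) * (1 + 6 / (klScale klE0 (m + 1)) * ((klScale klE0 (m + 1)) / 128 + (5 : ℝ) * (R.Gfr 0 * |U| * Θ * ((16 : ℝ) ^ m)⁻¹)))))) ^ k := by
  have hX0 : (0 : ℝ) ≤ klChi2CauchyTab2 4 := by norm_num [klChi2CauchyTab2]
  have hW0 : 0 ≤ W := by
    rw [hW]; have h1 := curveExtC_nonneg hX0 hGS 1; have h2 := curveExtC_nonneg hX0 hQS 1; positivity
  have hΞ0 : 0 ≤ Ξ := by rw [hΞ]; exact Xi_nonneg hR hW0 U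
  have hΘ0 : 0 ≤ Θ := by rw [hΘ]; exact Theta_nonneg hR hR0 hW0 U
  have hΞ' : ∀ i, 1 ≤ i → (if i ≤ 4 then R.Gfr i * uPow i U else 2 ^ i * (Real.pi ^ 8 / 4 * 2 ^ (i - 1) * (2 : ℝ) ^ (8 * (i - 1))) * ((curveExtC (klChi2CauchyTab2 4) G.S 1 + curveExtC (klChi2CauchyTab2 4) Q.S' 1 * |U|) * U ^ 2)) ≤ i ! * Ξ ^ i := by
    intro i hi; rw [hΞ, ← hW]; exact flowTableA_le_factorial_mul_pow hR hW0 hU1 hi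
  have hΘΦ : ∀ i : ℕ, (if i ≤ 4 then R.Gfr i * uPow i U else 2 ^ i * (Real.pi ^ 8 / 4 * 2 ^ (i - 1) * (2 : ℝ) ^ (8 * (i - 1))) * ((curveExtC (klChi2CauchyTab2 4) G.S 1 + curveExtC (klChi2CauchyTab2 4) Q.S' 1 * |U|) * U ^ 2)) ≤ R.Gfr 0 * |U| * Θ * i ! * (2 ^ 10 * (1 : ℝ)) ^ i := by
    intro i; rw [hΘ, ← hW]; exact flowTableA_le_mul_factorial_mul_pow hR hR0 hW0 U i
  have hδΛ : R.Gfr 0 * |U| * Θ * ((16 : ℝ) ^ m)⁻¹ ≤ klScale klE0 (m + 1) / 4 := by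
    rw [hΘ]; exact Gfr_mul_Theta_inv_pow_le_klScale_succ_div_four hR0 hdoor m
  exact lastNegJ₂_sup_flow_le_gevrey hR hGS hQS hβ hμ hP hT hmn hΞ0 hΘ0 zero_le_one hΞ' hΘΦ hδΛ k q

/-- **Gevrey sup of `J₁` (the `R_b` symbol) at the flow step, CLOSED ENVELOPES** (`Φ = 1`; `W, Ξ, Θ` bound by their defining equations `hW, hΞ, hΘ`; one `U`-door).
[cite: BenfattoGiulianiMastropietro2006, §2.2 (2.23), (2.27)–(2.28), §3 (3.2)] -/
theorem lastJ₁_sup_flow_le_closed (k : ℕ) (q : Momentum) :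
    ‖iteratedFDeriv ℝ k (fun q : Momentum => ((((evalM (fsub (klFlowFrameU L M β U μ m) (klFlowFrameU L M β U μ (m + 1))) q / (β * (L : ℝ) ^ 2) : ℝ)) : ℂ) * (((uvWeightFn (klScale
      klE0 (m + 1)) (matsubaraFreq β M (omega0 M)) (frameLevel μ (klFlowFrameU L M β U μ m) q) : ℝ) : ℂ) * resolventFnXi (β * (L : ℝ) ^ 2) 0 (matsubaraFreq β M (omega0 M)) (frameLevel
      μ (klFlowFrameU L M β U μ m) q + uvWeightFn (klScale klE0 (m + 1)) (matsubaraFreq β M (omega0 M)) (frameLevel μ (klFlowFrameU L M β U μ m) q) * evalM (fsub (klFlowFrameU L M β U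
      μ m) (klFlowFrameU L M β U μ (m + 1))) q))) * ((((evalM (fsub (klFlowFrameU L M β U μ m) (klFlowFrameU L M β U μ (m + 1))) q / (β * (L : ℝ) ^ 2) : ℝ)) : ℂ) * (((uvWeightFn
      (klScale klE0 (m + 1)) (matsubaraFreq β M (omega0 M)) (frameLevel μ (klFlowFrameU L M β U μ m) q) : ℝ) : ℂ) * resolventFnXi (β * (L : ℝ) ^ 2) 0 (matsubaraFreq β M (omega0 M))
      (frameLevel μ (klFlowFrameU L M β U μ m) q + uvWeightFn (klScale klE0 (m + 1)) (matsubaraFreq β M (omega0 M)) (frameLevel μ (klFlowFrameU L M β U μ m) q) * evalM (fsub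
      (klFlowFrameU L M β U μ m) (klFlowFrameU L M β U μ (m + 1))) q))) - (2 : ℂ) * ((((evalM (fsub (klFlowFrameU L M β U μ m) (klFlowFrameU L M β U μ (m + 1))) q / (β * (L : ℝ) ^ 2) :
      ℝ)) : ℂ) * (((uvWeightFn (klScale klE0 (m + 1)) (matsubaraFreq β M (omega0 M)) (frameLevel μ (klFlowFrameU L M β U μ m) q) : ℝ) : ℂ) * resolventFnXi (β * (L : ℝ) ^ 2) 0
      (matsubaraFreq β M (omega0 M)) (frameLevel μ (klFlowFrameU L M β U μ m) q + uvWeightFn (klScale klE0 (m + 1)) (matsubaraFreq β M (omega0 M)) (frameLevel μ (klFlowFrameU L M β U μ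
      m) q) * evalM (fsub (klFlowFrameU L M β U μ m) (klFlowFrameU L M β U μ (m + 1))) q)))) q‖ ≤
      ((R.Gfr 0 * |U| * Θ * ((16 : ℝ) ^ m)⁻¹) / |(β * (L : ℝ) ^ 2)| * ((5 : ℝ) * (|(β * (L : ℝ) ^ 2)| * (6 / (klScale klE0 (m + 1)))))) * ((R.Gfr 0 * |U| * Θ * ((16 : ℝ) ^ m)⁻¹) / |(β
        * (L : ℝ) ^ 2)| * ((5 : ℝ) * (|(β * (L : ℝ) ^ 2)| * (6 / (klScale klE0 (m + 1)))))) * ((k ! : ℝ)) ^ 2 * (2 * (2 * (2 * (2 ^ 10 * (1 : ℝ) * (4 : ℝ) ^ m) + 2 * (4 * (2 * (4 * (4 +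
        (4 : ℝ) ^ m * Ξ) * (1 + 16 * (1 + (27 / 10 : ℝ)) / (klScale klE0 (m + 1)) * 1) + (2 ^ 10 * (1 : ℝ) * (4 : ℝ) ^ m))) * (1 + 6 / (klScale klE0 (m + 1)) * ((klScale klE0 (m + 1)) /
        128 + (5 : ℝ) * (R.Gfr 0 * |U| * Θ * ((16 : ℝ) ^ m)⁻¹))))))) ^ k + 2 * (((R.Gfr 0 * |U| * Θ * ((16 : ℝ) ^ m)⁻¹) / |(β * (L : ℝ) ^ 2)|) * ((5 : ℝ) * (|(β * (L : ℝ) ^ 2)| * (6 /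
        (klScale klE0 (m + 1))))) * ((k ! : ℝ)) ^ 2 * (2 * (2 * (2 ^ 10 * (1 : ℝ) * (4 : ℝ) ^ m) + 2 * (4 * (2 * (4 * (4 + (4 : ℝ) ^ m * Ξ) * (1 + 16 * (1 + (27 / 10 : ℝ)) / (klScale
        klE0 (m + 1)) * 1) + (2 ^ 10 * (1 : ℝ) * (4 : ℝ) ^ m))) * (1 + 6 / (klScale klE0 (m + 1)) * ((klScale klE0 (m + 1)) / 128 + (5 : ℝ) * (R.Gfr 0 * |U| * Θ * ((16 : ℝ) ^ m)⁻¹))))))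
        ^ k) := by
  have hX0 : (0 : ℝ) ≤ klChi2CauchyTab2 4 := by norm_num [klChi2CauchyTab2]
  have hW0 : 0 ≤ W := by
    rw [hW]; have h1 := curveExtC_nonneg hX0 hGS 1; have h2 := curveExtC_nonneg hX0 hQS 1; positivity
  have hΞ0 : 0 ≤ Ξ := by rw [hΞ]; exact Xi_nonneg hR hW0 U
  have hΘ0 : 0 ≤ Θ := by rw [hΘ]; exact Theta_nonneg hR hR0 hW0 U
  have hΞ' : ∀ i, 1 ≤ i → (if i ≤ 4 then R.Gfr i * uPow i U else 2 ^ i * (Real.pi ^ 8 / 4 * 2 ^ (i - 1) * (2 : ℝ) ^ (8 * (i - 1))) * ((curveExtC (klChi2CauchyTab2 4) G.S 1 + curveExtC (klChi2CauchyTab2 4) Q.S' 1 * |U|) * U ^ 2)) ≤ i ! * Ξ ^ i := by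
    intro i hi; rw [hΞ, ← hW]; exact flowTableA_le_factorial_mul_pow hR hW0 hU1 hi
  have hΘΦ : ∀ i : ℕ, (if i ≤ 4 then R.Gfr i * uPow i U else 2 ^ i * (Real.pi ^ 8 / 4 * 2 ^ (i - 1) * (2 : ℝ) ^ (8 * (i - 1))) * ((curveExtC (klChi2CauchyTab2 4) G.S 1 + curveExtC (klChi2CauchyTab2 4) Q.S' 1 * |U|) * U ^ 2)) ≤ R.Gfr 0 * |U| * Θ * i ! * (2 ^ 10 * (1 : ℝ)) ^ i := by
    intro i; rw [hΘ, ← hW]; exact flowTableA_le_mul_factorial_mul_pow hR hR0 hW0 U i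
  have hδΛ : R.Gfr 0 * |U| * Θ * ((16 : ℝ) ^ m)⁻¹ ≤ klScale klE0 (m + 1) / 4 := by
    rw [hΘ]; exact Gfr_mul_Theta_inv_pow_le_klScale_succ_div_four hR0 hdoor m
  exact lastJ₁_sup_flow_le_gevrey hR hGS hQS hβ hμ hP hT hmn hΞ0 hΘ0 zero_le_one hΞ' hΘΦ hδΛ k q

/-- **Gevrey sup of `−i·J₁` (the `R_c` symbol) at the flow step, CLOSED ENVELOPES** (`Φ = 1`; `W, Ξ, Θ` bound by their defining equations `hW, hΞ, hΘ`; one `U`-door).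
[cite: BenfattoGiulianiMastropietro2006, §2.2 (2.23), (2.27)–(2.28), §3 (3.2)] -/
theorem lastNegIJ₁_sup_flow_le_closed (k : ℕ) (q : Momentum) :
    ‖iteratedFDeriv ℝ k (fun q : Momentum => -I * (((((evalM (fsub (klFlowFrameU L M β U μ m) (klFlowFrameU L M β U μ (m + 1))) q / (β * (L : ℝ) ^ 2) : ℝ)) : ℂ) * (((uvWeightFn
      (klScale klE0 (m + 1)) (matsubaraFreq β M (omega0 M)) (frameLevel μ (klFlowFrameU L M β U μ m) q) : ℝ) : ℂ) * resolventFnXi (β * (L : ℝ) ^ 2) 0 (matsubaraFreq β M (omega0 M))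
      (frameLevel μ (klFlowFrameU L M β U μ m) q + uvWeightFn (klScale klE0 (m + 1)) (matsubaraFreq β M (omega0 M)) (frameLevel μ (klFlowFrameU L M β U μ m) q) * evalM (fsub
      (klFlowFrameU L M β U μ m) (klFlowFrameU L M β U μ (m + 1))) q))) * ((((evalM (fsub (klFlowFrameU L M β U μ m) (klFlowFrameU L M β U μ (m + 1))) q / (β * (L : ℝ) ^ 2) : ℝ)) : ℂ)
      * (((uvWeightFn (klScale klE0 (m + 1)) (matsubaraFreq β M (omega0 M)) (frameLevel μ (klFlowFrameU L M β U μ m) q) : ℝ) : ℂ) * resolventFnXi (β * (L : ℝ) ^ 2) 0 (matsubaraFreq β M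
      (omega0 M)) (frameLevel μ (klFlowFrameU L M β U μ m) q + uvWeightFn (klScale klE0 (m + 1)) (matsubaraFreq β M (omega0 M)) (frameLevel μ (klFlowFrameU L M β U μ m) q) * evalM
      (fsub (klFlowFrameU L M β U μ m) (klFlowFrameU L M β U μ (m + 1))) q))) - (2 : ℂ) * ((((evalM (fsub (klFlowFrameU L M β U μ m) (klFlowFrameU L M β U μ (m + 1))) q / (β * (L : ℝ)
      ^ 2) : ℝ)) : ℂ) * (((uvWeightFn (klScale klE0 (m + 1)) (matsubaraFreq β M (omega0 M)) (frameLevel μ (klFlowFrameU L M β U μ m) q) : ℝ) : ℂ) * resolventFnXi (β * (L : ℝ) ^ 2) 0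
      (matsubaraFreq β M (omega0 M)) (frameLevel μ (klFlowFrameU L M β U μ m) q + uvWeightFn (klScale klE0 (m + 1)) (matsubaraFreq β M (omega0 M)) (frameLevel μ (klFlowFrameU L M β U μ
      m) q) * evalM (fsub (klFlowFrameU L M β U μ m) (klFlowFrameU L M β U μ (m + 1))) q))))) q‖ ≤
      ((R.Gfr 0 * |U| * Θ * ((16 : ℝ) ^ m)⁻¹) / |(β * (L : ℝ) ^ 2)| * ((5 : ℝ) * (|(β * (L : ℝ) ^ 2)| * (6 / (klScale klE0 (m + 1)))))) * ((R.Gfr 0 * |U| * Θ * ((16 : ℝ) ^ m)⁻¹) / |(β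
        * (L : ℝ) ^ 2)| * ((5 : ℝ) * (|(β * (L : ℝ) ^ 2)| * (6 / (klScale klE0 (m + 1)))))) * ((k ! : ℝ)) ^ 2 * (2 * (2 * (2 * (2 ^ 10 * (1 : ℝ) * (4 : ℝ) ^ m) + 2 * (4 * (2 * (4 * (4 +
        (4 : ℝ) ^ m * Ξ) * (1 + 16 * (1 + (27 / 10 : ℝ)) / (klScale klE0 (m + 1)) * 1) + (2 ^ 10 * (1 : ℝ) * (4 : ℝ) ^ m))) * (1 + 6 / (klScale klE0 (m + 1)) * ((klScale klE0 (m + 1)) /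
        128 + (5 : ℝ) * (R.Gfr 0 * |U| * Θ * ((16 : ℝ) ^ m)⁻¹))))))) ^ k + 2 * (((R.Gfr 0 * |U| * Θ * ((16 : ℝ) ^ m)⁻¹) / |(β * (L : ℝ) ^ 2)|) * ((5 : ℝ) * (|(β * (L : ℝ) ^ 2)| * (6 /
        (klScale klE0 (m + 1))))) * ((k ! : ℝ)) ^ 2 * (2 * (2 * (2 ^ 10 * (1 : ℝ) * (4 : ℝ) ^ m) + 2 * (4 * (2 * (4 * (4 + (4 : ℝ) ^ m * Ξ) * (1 + 16 * (1 + (27 / 10 : ℝ)) / (klScale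
        klE0 (m + 1)) * 1) + (2 ^ 10 * (1 : ℝ) * (4 : ℝ) ^ m))) * (1 + 6 / (klScale klE0 (m + 1)) * ((klScale klE0 (m + 1)) / 128 + (5 : ℝ) * (R.Gfr 0 * |U| * Θ * ((16 : ℝ) ^ m)⁻¹))))))
        ^ k) := by
  have hX0 : (0 : ℝ) ≤ klChi2CauchyTab2 4 := by norm_num [klChi2CauchyTab2]
  have hW0 : 0 ≤ W := by
    rw [hW]; have h1 := curveExtC_nonneg hX0 hGS 1; have h2 := curveExtC_nonneg hX0 hQS 1; positivity
  have hΞ0 : 0 ≤ Ξ := by rw [hΞ]; exact Xi_nonneg hR hW0 U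
  have hΘ0 : 0 ≤ Θ := by rw [hΘ]; exact Theta_nonneg hR hR0 hW0 U
  have hΞ' : ∀ i, 1 ≤ i → (if i ≤ 4 then R.Gfr i * uPow i U else 2 ^ i * (Real.pi ^ 8 / 4 * 2 ^ (i - 1) * (2 : ℝ) ^ (8 * (i - 1))) * ((curveExtC (klChi2CauchyTab2 4) G.S 1 + curveExtC (klChi2CauchyTab2 4) Q.S' 1 * |U|) * U ^ 2)) ≤ i ! * Ξ ^ i := by
    intro i hi; rw [hΞ, ← hW]; exact flowTableA_le_factorial_mul_pow hR hW0 hU1 hi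
  have hΘΦ : ∀ i : ℕ, (if i ≤ 4 then R.Gfr i * uPow i U else 2 ^ i * (Real.pi ^ 8 / 4 * 2 ^ (i - 1) * (2 : ℝ) ^ (8 * (i - 1))) * ((curveExtC (klChi2CauchyTab2 4) G.S 1 + curveExtC (klChi2CauchyTab2 4) Q.S' 1 * |U|) * U ^ 2)) ≤ R.Gfr 0 * |U| * Θ * i ! * (2 ^ 10 * (1 : ℝ)) ^ i := by
    intro i; rw [hΘ, ← hW]; exact flowTableA_le_mul_factorial_mul_pow hR hR0 hW0 U i
  have hδΛ : R.Gfr 0 * |U| * Θ * ((16 : ℝ) ^ m)⁻¹ ≤ klScale klE0 (m + 1) / 4 := by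
    rw [hΘ]; exact Gfr_mul_Theta_inv_pow_le_klScale_succ_div_four hR0 hdoor m
  exact lastNegIJ₁_sup_flow_le_gevrey hR hGS hQS hβ hμ hP hT hmn hΞ0 hΘ0 zero_le_one hΞ' hΘΦ hδΛ k q

end Closed

end Summit.HubbardSuperconductivity.HubbardSuperconductivity.Theorems.EngineV8

end
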